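import Summits.AtomisticToContinuum.BoseEinsteinCondensation.Theses.BECInsertionCorrector
import Summits.AtomisticToContinuum.BoseEinsteinCondensation.Theorems.StaticResponseBound.Negative.Basic
import Summits.AtomisticToContinuum.BoseEinsteinCondensation.Theorems.BECInsertionCorrectorStaticResponseBoundFreeSquare
import Literature.MathematicalPhysics.QuantumManyBody.BoseGasStructureFactor
import HarnessLib

/-!
# Stub A of line `stable-fraction-square-completion` is EQUIVALENT to its consequence ECSF
# (negative-side structural lemma for crux `StaticResponseBound`, stmt-AtomisticToContinuum-12057)

Supports (does not close) stmt-AtomisticToContinuum-12057.  Drefute generation 4 on the PICKED line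
`stable-fraction-square-completion` (lead skeleton v2, `Cruxes/StaticResponseBound/Lines/…`).

The line's LEVER is stub **A** `stub_softenedModeHyperuniformity`: every finite-energy
`δ`-near-minimiser `Φ` of the SOFTENED functional `F_θ(Φ) = E_Φ − λ_θ(R_Φ − N)`,
`λ_θ = θ g_p/L³`, `R_Φ = ⟨|ρ̂_p|²⟩_Φ`, is hyperuniform at `p`: `R_Φ ≤ C_H N|p|/√(ρa)`.  The lead's
landed C1 (`…StableFractionSquareCompletion.stub_ecsf_of_hyperuniformity`, variational principle)
turns A into the ENERGY-CONTROLLED STRUCTURE FACTOR (ECSF) for EVERY finite-energy state,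
`λ_θ R_Φ ≤ (E_Φ − E₀) + λ_θ C_H N|p|/√(ρa)`, with the same constants.

**This file proves the converse**: ECSF with constants `(ρ₀, θ, C_H)` implies A with constants
`(ρ₀, θ/2, 2C_H + 1)` (`stub_softenedModeHyperuniformity_of_ecsf`), hence
`A ↔ ECSF` as registered texts (`stub_softenedModeHyperuniformity_iff_ecsf`).  Mechanism
(`hyperuniformity_of_ecsf`, pure real-variable bookkeeping): a `δ`-near-minimiser `Φ` of `F_{θ/2}`
compared with an `ε`-ground state `Ψ` has `E_Φ − E₀ ≤ λ_{θ/2} R_Φ + δ + ε` (drop `−λR_Ψ ≤ 0`), and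
ECSF at the DOUBLE coupling `λ_θ = 2λ_{θ/2}` gives `2λ R_Φ ≤ (E_Φ − E₀) + 2λH ≤ λR_Φ + δ + ε + 2λH`,
i.e. `R_Φ ≤ 2H + δ/λ`; choose `δ := λ · N|p|/√(ρa)`.

**Reading for the lead / planners (refuter's finding, not a refutation).**  The softened
functional, its near-minimisers and the "stable fraction `θ` of the Bogoliubov vertex" carry NO
information beyond the all-states inequality ECSF itself: stub A is ECSF in Legendre costume, and
the line is exactly `ECSF ∧ SectorFloor ⟹ StaticResponseBoundPhonon` (C2α, C2β, C3 classical).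
Whoever attacks A may therefore drop `IsSoftenedNearMin` entirely and prove ECSF directly (and, by
the sector-diagonality of `|ρ̂_p|²`, only for sector-pure states, where `R_Φ = N·S_Φ(p)` is the
genuine structure factor); conversely no stability analysis of the softened `N`-body problem can be
easier than ECSF.  Both directions are kernel-checked; no new definitions.
-/

namespace Summit.AtomisticToContinuum.BoseEinsteinCondensation.Theorems.StaticResponseBound.Negative

open MeasureTheory
open scoped ENNReal
open Literature.MathematicalPhysics.QuantumManyBody.BoseGas
open Summit.AtomisticToContinuum.BoseEinsteinCondensation.Theses
open Summit.AtomisticToContinuum.BoseEinsteinCondensation.Cruxes.StaticResponseBound.UvThomsonForceWave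
  (freeSq_psq_pos)

noncomputable section

/-- **Abstract converse of the variational principle.** On an index type with admissibility `P`,
energies `E` whose infimum over admissible indices is approached (`hE₀`), a non-negative observable
`R` and couplings `0 ≤ lam < lam'`: if ECSF holds at coupling `lam'`
(`lam'·R i ≤ E i − E₀ + lam'·H` for all admissible `i`), then every admissible `δ`-near-minimiser
`i` of the softened functional `E − lam(R − c)` has `R i ≤ (lam'·H + δ)/(lam' − lam)`. [folklore] -/
theorem hyperuniformity_of_ecsf {ι : Type*} (P : ι → Prop) (E R : ι → ℝ)
    {lam lam' c E₀ H δ : ℝ} (hlam : 0 ≤ lam) (hll : lam < lam')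
    (hE₀ : ∀ ε : ℝ, 0 < ε → ∃ j, P j ∧ E j ≤ E₀ + ε)
    (hR : ∀ j, P j → 0 ≤ R j)
    (hecsf : ∀ i, P i → lam' * R i ≤ E i - E₀ + lam' * H)
    (i : ι) (hi : P i ∧ ∀ j, P j → E i - lam * (R i - c) ≤ E j - lam * (R j - c) + δ) :
    R i ≤ (lam' * H + δ) / (lam' - lam) := by
  have hpos : 0 < lam' - lam := sub_pos.mpr hll
  rw [le_div_iff₀ hpos]
  refine le_of_forall_pos_le_add fun ε hε => ?_
  obtain ⟨j, hj, hEj⟩ := hE₀ ε hε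
  have h1 := hi.2 j hj
  have h2 : 0 ≤ lam * R j := mul_nonneg hlam (hR j hj)
  have h3 := hecsf i hi.1
  nlinarith

/-- The ground-state energy is approached by finite-energy states (in `toReal`), as soon as one
finite-energy state exists. [folklore] -/
theorem exists_periodicEnergy_toReal_le (v : ℝ → ℝ≥0∞) {N : ℕ} {L : ℝ}
    (Φ : PeriodicTrialState N L) (hΦ : periodicEnergy v Φ ≠ ⊤) {ε : ℝ} (hε : 0 < ε) :
    ∃ Ψ : PeriodicTrialState N L, periodicEnergy v Ψ ≠ ⊤ ∧
      (periodicEnergy v Ψ).toReal ≤ (periodicGroundStateEnergy v N L).toReal + ε := by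
  have hE₀ : periodicGroundStateEnergy v N L ≠ ⊤ :=
    ne_top_of_le_ne_top hΦ (periodicGroundStateEnergy_le v Φ)
  have hlt : periodicGroundStateEnergy v N L <
      periodicGroundStateEnergy v N L + ENNReal.ofReal ε :=
    ENNReal.lt_add_right hE₀ (by simpa using hε)
  obtain ⟨Ψ, hΨ⟩ := iInf_lt_iff.mp hlt
  have htop : periodicGroundStateEnergy v N L + ENNReal.ofReal ε ≠ ⊤ :=
    ENNReal.add_ne_top.mpr ⟨hE₀, ENNReal.ofReal_ne_top⟩
  refine ⟨Ψ, ne_top_of_lt hΨ, ?_⟩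
  have := ENNReal.toReal_mono htop hΨ.le
  rwa [ENNReal.toReal_add hE₀ ENNReal.ofReal_ne_top, ENNReal.toReal_ofReal hε.le] at this

/-- **ECSF ⟹ A** (converse of the lead's C1, registered texts verbatim): the energy-controlled
structure factor with constants `(ρ₀, θ, C_H)` implies softened-mode hyperuniformity of the
near-minimisers with constants `(ρ₀, θ/2, 2C_H + 1)` and tolerance
`δ = λ_{θ/2} · N|p|/√(ρa)`. [folklore] -/
theorem stub_softenedModeHyperuniformity_of_ecsf :
    (∀ v : ℝ → ℝ≥0∞, IsRepulsiveFiniteRange v → ∀ M₀ : ℝ, 0 < M₀ →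
      ∃ ρ₀ : ℝ, 0 < ρ₀ ∧ ∃ θ : ℝ, 0 < θ ∧ ∃ C_H : ℝ, 0 ≤ C_H ∧
        ∀ ρ : ℝ, 0 < ρ → ρ < ρ₀ → ∀ N : ℕ, 0 < N → ∀ k : Fin 3 → ℤ, k ≠ 0 →
          psq (sideLength ρ N) k ≤ M₀ ^ 2 * (ρ * (scatteringLength v).toReal) →
          ∀ Φ : PeriodicTrialState N (sideLength ρ N), periodicEnergy v Φ ≠ ⊤ →
            θ * (8 * Real.pi * (scatteringLength v).toReal + psq (sideLength ρ N) k / (2 * ρ)) /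
                sideLength ρ N ^ 3 *
                (∫ X in cellN N (sideLength ρ N),
                  ‖densityWave N (sideLength ρ N) k X‖ ^ 2 * ‖Φ.ψ X‖ ^ 2) ≤
              (periodicEnergy v Φ).toReal - (periodicGroundStateEnergy v N (sideLength ρ N)).toReal +
                θ * (8 * Real.pi * (scatteringLength v).toReal + psq (sideLength ρ N) k / (2 * ρ)) /
                  sideLength ρ N ^ 3 *
                  (C_H * N * Real.sqrt (psq (sideLength ρ N) k) /
                    Real.sqrt (ρ * (scatteringLength v).toReal))) →
    ∀ v : ℝ → ℝ≥0∞, IsRepulsiveFiniteRange v → ∀ M₀ : ℝ, 0 < M₀ →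
      ∃ ρ₀ : ℝ, 0 < ρ₀ ∧ ∃ θ : ℝ, 0 < θ ∧ ∃ C_H : ℝ, 0 ≤ C_H ∧
        ∀ ρ : ℝ, 0 < ρ → ρ < ρ₀ → ∀ N : ℕ, 0 < N → ∀ k : Fin 3 → ℤ, k ≠ 0 →
          psq (sideLength ρ N) k ≤ M₀ ^ 2 * (ρ * (scatteringLength v).toReal) →
          ∃ δ : ℝ, 0 < δ ∧ ∀ Φ : PeriodicTrialState N (sideLength ρ N),
            (periodicEnergy v Φ ≠ ⊤ ∧
              ∀ Φ' : PeriodicTrialState N (sideLength ρ N), periodicEnergy v Φ' ≠ ⊤ →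
                (periodicEnergy v Φ).toReal -
                    θ * (8 * Real.pi * (scatteringLength v).toReal +
                        psq (sideLength ρ N) k / (2 * ρ)) / sideLength ρ N ^ 3 *
                      ((∫ X in cellN N (sideLength ρ N),
                          ‖densityWave N (sideLength ρ N) k X‖ ^ 2 * ‖Φ.ψ X‖ ^ 2) - N) ≤
                  (periodicEnergy v Φ').toReal -
                    θ * (8 * Real.pi * (scatteringLength v).toReal +
                        psq (sideLength ρ N) k / (2 * ρ)) / sideLength ρ N ^ 3 *
                      ((∫ X in cellN N (sideLength ρ N),
                          ‖densityWave N (sideLength ρ N) k X‖ ^ 2 * ‖Φ'.ψ X‖ ^ 2) - N) + δ) →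
            (∫ X in cellN N (sideLength ρ N),
                ‖densityWave N (sideLength ρ N) k X‖ ^ 2 * ‖Φ.ψ X‖ ^ 2) ≤
              C_H * N * Real.sqrt (psq (sideLength ρ N) k) /
                Real.sqrt (ρ * (scatteringLength v).toReal) := by
  intro hE v hv M₀ hM₀
  obtain ⟨ρ₀, hρ₀, θ, hθ, C_H, hC_H, hwin⟩ := hE v hv M₀ hM₀
  refine ⟨ρ₀, hρ₀, θ / 2, by positivity, 2 * C_H + 1, by positivity, ?_⟩
  intro ρ hρ hρlt N hN k hk hwindow
  have hecsf := hwin ρ hρ hρlt N hN k hk hwindow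
  -- abbreviations
  set L := sideLength ρ N with hLdef
  set a := (scatteringLength v).toReal with hadef
  set g := 8 * Real.pi * a + psq L k / (2 * ρ) with hgdef
  set U := (N : ℝ) * Real.sqrt (psq L k) / Real.sqrt (ρ * a) with hUdef
  set R : PeriodicTrialState N L → ℝ := fun Ψ =>
    ∫ X in cellN N L, ‖densityWave N L k X‖ ^ 2 * ‖Ψ.ψ X‖ ^ 2 with hRdef
  have hL : 0 < L := sideLength_pos hρ hN
  have hpsq : 0 < psq L k := freeSq_psq_pos hL hk
  have ha0 : 0 ≤ a := ENNReal.toReal_nonneg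
  have hρa : 0 < ρ * a := by
    have h1 : 0 < M₀ ^ 2 * (ρ * a) := lt_of_lt_of_le hpsq hwindow
    by_contra h
    push Not at h
    have : M₀ ^ 2 * (ρ * a) ≤ 0 := mul_nonpos_of_nonneg_of_nonpos (sq_nonneg _) h
    linarith
  have hg : 0 < g := by
    have : 0 < psq L k / (2 * ρ) := by positivity
    have : 0 ≤ 8 * Real.pi * a := by positivity
    linarith
  have hL3 : 0 < L ^ 3 := by positivity
  set lam := θ / 2 * g / L ^ 3 with hlamdef
  have hlam : 0 < lam := by positivity
  have hNpos : (0 : ℝ) < N := by exact_mod_cast hN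
  have hU : 0 < U := by
    have : 0 < Real.sqrt (psq L k) := Real.sqrt_pos.mpr hpsq
    have : 0 < Real.sqrt (ρ * a) := Real.sqrt_pos.mpr hρa
    positivity
  refine ⟨lam * U, mul_pos hlam hU, ?_⟩
  intro Φ hΦ
  -- the abstract converse with `lam' = 2 lam = θ g / L³`
  have hlam' : θ * g / L ^ 3 = 2 * lam := by rw [hlamdef]; ring
  have key := hyperuniformity_of_ecsf
    (P := fun Ψ : PeriodicTrialState N L => periodicEnergy v Ψ ≠ ⊤)
    (E := fun Ψ : PeriodicTrialState N L => (periodicEnergy v Ψ).toReal)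
    (R := R) (lam := lam) (lam' := 2 * lam) (c := (N : ℝ))
    (E₀ := (periodicGroundStateEnergy v N L).toReal) (H := C_H * U) (δ := lam * U)
    hlam.le (by linarith)
    (fun ε hε => by
      obtain ⟨Ψ, hΨ, hle⟩ := exists_periodicEnergy_toReal_le v Φ hΦ.1 hε
      exact ⟨Ψ, hΨ, hle⟩)
    (fun Ψ _ => integral_nonneg fun X => by positivity)
    (fun Ψ hΨ => by
      have h := hecsf Ψ hΨ
      rw [hlam'] at h
      have hH : 2 * lam * (C_H * ↑N * Real.sqrt (psq L k) / Real.sqrt (ρ * a)) =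
          2 * lam * (C_H * U) := by rw [hUdef]; ring
      rw [hH] at h
      exact h)
    Φ hΦ
  -- `(2 lam · C_H U + lam U) / (2 lam − lam) = (2 C_H + 1) U`
  have hsimp : (2 * lam * (C_H * U) + lam * U) / (2 * lam - lam) = (2 * C_H + 1) * U := by
    have : 2 * lam - lam = lam := by ring
    rw [this]
    field_simp
  rw [hsimp] at key
  calc R Φ ≤ (2 * C_H + 1) * U := key
    _ = (2 * C_H + 1) * ↑N * Real.sqrt (psq L k) / Real.sqrt (ρ * a) := by
        rw [hUdef]; ring

end

end Summit.AtomisticToContinuum.BoseEinsteinCondensation.Theorems.StaticResponseBound.Negative
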